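import Literature.Probability.LatticeModels.PSPolymerActivity
import HarnessLib

/-!
# Pirogov–Sinai theory, V: pressure of a contour polymer model and its finite-volume bounds

Topic `Literature/Probability/LatticeModels`. The content of Friedli–Velenik's Theorem 7.29 and
Lemma 7.31 that is needed by the pointwise (derivative-free) Pirogov–Sinai argument, for the contour
polymer models of `PSPolymerActivity` (weights `0 ≤ W ≤ e^{-τ|γ̄|}` merged into the small
translation-invariant subset activity `ρ̂`, `IsSmallTIActivity (rhoHat σ W) δ`):

* the **pressure** `g = pressureOf σ W` (the real part of the Kotecký–Preiss pressure of `ρ̂`,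
  eq. (7.53)) satisfies `0 ≤ g` and `|g| ≤ e^{-δ}` (eq. (7.53): `|g| ≤ η`);
* **volume and boundary terms for every finite volume** (eq. (7.54)): for `δ ≥ 2d + 1`,
  `|log Ξ(V) - g |V|| ≤ |∂^in V|` (`abs_log_compSum_sub_le`);
* **two weight systems that differ only on contours with large encoded support have close
  pressures** (the use of Lemma 7.31 in §7.4.3): `|g_W - g_{W'}| ≤ 2 e^{-δ L₀}`
  (`abs_pressureOf_sub_le`).

Everything is proved (on top of `PolymerPressure.lean`, i.e. the Kotecký–Preiss theorem); no named
facts.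

## References

* S. Friedli, Y. Velenik, *Statistical Mechanics of Lattice Systems*, CUP 2017, §7.4.2,
  Thm. 7.29 (eqs. (7.53)–(7.54)) and Lemma 7.31 (eq. (7.60)). [FriedliVelenik2017]
* R. Kotecký, D. Preiss, Comm. Math. Phys. 103 (1986) 491–498. [KoteckyPreiss1986]
-/

noncomputable section

open Finset Relation Filter Topology

namespace Literature.Probability.LatticeModels

namespace ContourSetup

variable {d : ℕ} {S : ContourSetup d} {σ : Phase} {W : S.Γ → ℝ} {δ : ℝ}

/-! ### The partition functions are real numbers `≥ 1` -/

/-- The subset-polymer partition function of the merged activity is a real number: the sum over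
compatible families of products of the (non-negative) merged weights. [cite: FriedliVelenik2017, §7.4.2, eq. (7.48)] -/
theorem polymerPartitionFunction_rhoHat_eq (σ : Phase) (W : S.Γ → ℝ) (Q : Finset (Finset (Site d))) :
    polymerPartitionFunction polyInc (S.rhoHat σ W) Q =
      (((∑ X ∈ Q.powerset with IsCompatible polyInc X, ∏ B ∈ X, ∑ γ ∈ S.fibCs σ B, W γ) : ℝ) : ℂ) := by
  rw [polymerPartitionFunction, sum_filter]
  push_cast
  refine sum_congr rfl fun X _ => ?_
  split_ifs
  · simp only [rhoHat_eq]; push_cast; rfl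
  · rfl

/-- The real form of the partition function is at least `1` (the empty family). [folklore] -/
theorem one_le_sum_compatible (hW0 : ∀ γ, 0 ≤ W γ) (Q : Finset (Finset (Site d))) :
    1 ≤ ∑ X ∈ Q.powerset with IsCompatible polyInc X, ∏ B ∈ X, ∑ γ ∈ S.fibCs σ B, W γ := by
  have hmem : (∅ : Finset (Finset (Site d))) ∈ Q.powerset.filter fun X => IsCompatible polyInc X :=
    mem_filter.2 ⟨empty_mem_powerset _, isCompatible_empty⟩
  have h := single_le_sum (f := fun X : Finset (Finset (Site d)) => ∏ B ∈ X, ∑ γ ∈ S.fibCs σ B, W γ)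
    (fun X _ => prod_nonneg fun B _ => sum_nonneg fun γ _ => hW0 γ) hmem
  rwa [prod_empty] at h

/-- **`Re log Ξ(𝒫) ≥ 0`**: the Kotecký–Preiss logarithm of the subset-polymer gas of the merged activity
has non-negative real part. [folklore] -/
theorem re_polymerLogZ_nonneg (h : IsSmallTIActivity (S.rhoHat σ W) δ) (hW0 : ∀ γ, 0 ≤ W γ) (Λ : Finset (Site d)) :
    0 ≤ (polymerLogZ polyInc (S.rhoHat σ W) Λ.powerset).re := by
  have hexp := h.exp_polymerLogZ_powerset Λ
  rw [polymerPartitionFunction_rhoHat_eq] at hexp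
  have hnorm := congrArg (‖·‖) hexp
  simp only [Complex.norm_exp, Complex.norm_real] at hnorm
  have h1 := one_le_sum_compatible (σ := σ) hW0 Λ.powerset
  rw [Real.norm_of_nonneg (by linarith)] at hnorm
  have : (1 : ℝ) ≤ Real.exp (polymerLogZ polyInc (S.rhoHat σ W) Λ.powerset).re := hnorm ▸ h1
  exact (Real.one_le_exp_iff).1 this |> fun h => h

/-- `Ξ(V) ≥ 1`. [folklore] -/
theorem one_le_compSum (hW0 : ∀ γ, 0 ≤ W γ) (V : Finset (Site d)) : 1 ≤ S.compSum σ W V := by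
  unfold compSum
  have h := single_le_sum (f := fun Δ : Finset S.Γ => ∏ δ ∈ Δ, W δ) (fun Δ _ => prod_nonneg fun δ _ => hW0 δ)
    (empty_mem_compFam (S := S) σ V)
  rwa [prod_empty] at h

/-- `Ξ(V) > 0`. [folklore] -/
theorem compSum_pos (hW0 : ∀ γ, 0 ≤ W γ) (V : Finset (Site d)) : 0 < S.compSum σ W V :=
  lt_of_lt_of_le one_pos (one_le_compSum hW0 V)

/-- `Ξ` is monotone in the weights. [folklore] -/
theorem compSum_mono {W' : S.Γ → ℝ} (hW0 : ∀ γ, 0 ≤ W' γ) (hle : ∀ γ, W' γ ≤ W γ) (V : Finset (Site d)) :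
    S.compSum σ W' V ≤ S.compSum σ W V :=
  sum_le_sum fun _ _ => prod_le_prod (fun γ _ => hW0 γ) fun γ _ => hle γ

/-- With no room for a contour, `Ξ(V) = 1`. [folklore] -/
theorem compSum_eq_one_of_Vhat_eq_empty {V : Finset (Site d)} (hV : Vhat V = ∅) : S.compSum σ W V = 1 := by
  have : S.CompFam σ V = {∅} := by
    refine eq_singleton_iff_unique_mem.2 ⟨empty_mem_compFam σ V, fun Δ hΔ => eq_empty_of_forall_notMem fun γ hγ => ?_⟩
    have h1 := inVol_iff_cs_subset.1 ((mem_compFam.1 hΔ).1 γ hγ).2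
    rw [hV, subset_empty] at h1
    exact (cs_nonempty (S.supp_nonempty γ)).ne_empty h1
  rw [compSum, this, sum_singleton, prod_empty]

/-- **`log Ξ(V) = Re log_KP Ξ(Vhat V)`**: the logarithm of the contour polymer partition function is the
real part of the Kotecký–Preiss logarithm of the subset-polymer gas in the shrunk volume.
[cite: FriedliVelenik2017, §7.4.2, eq. (7.50)] -/
theorem log_compSum_eq (h : IsSmallTIActivity (S.rhoHat σ W) δ) (hW0 : ∀ γ, 0 ≤ W γ) (V : Finset (Site d)) :
    Real.log (S.compSum σ W V) = (polymerLogZ polyInc (S.rhoHat σ W) (Vhat V).powerset).re := by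
  have hexp := h.exp_polymerLogZ_powerset (Vhat V)
  rw [← compSum_eq_polymerPartitionFunction] at hexp
  have hnorm := congrArg (‖·‖) hexp
  simp only [Complex.norm_exp, Complex.norm_real, Real.norm_of_nonneg (compSum_pos hW0 V).le] at hnorm
  rw [← hnorm, Real.log_exp]

/-! ### The pressure -/

variable (S) in
/-- **The pressure** `g` of the contour polymer model with weights `W` on the contours of type `σ`: the
real part of the Kotecký–Preiss pressure of the merged activity (FV eq. (7.53)).
[cite: FriedliVelenik2017, §7.4.2, Thm. 7.29, eq. (7.53)] -/
def pressureOf (σ : Phase) (W : S.Γ → ℝ) : ℝ := (polymerPressure (S.rhoHat σ W)).re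

/-- The local pressure of the empty volume vanishes. [folklore] -/
theorem localPolymerPressure_empty (ρ : Finset (Site d) → ℂ) (x : Site d) : localPolymerPressure ρ ∅ x = 0 := by
  rw [localPolymerPressure]
  refine sum_eq_zero fun C hC => ?_
  exfalso
  obtain ⟨hC, hx⟩ := mem_filter.1 hC
  obtain ⟨A, hA, hxA⟩ := mem_clusterSupp.1 hx
  have : A ∈ (∅ : Finset (Site d)).powerset := mem_powerset.1 hC hA
  rw [powerset_empty, mem_singleton] at this
  rw [this] at hxA
  exact notMem_empty x hxA

/-- **`|g| ≤ e^{-δ}`** (FV eq. (7.53): `|g| ≤ η(τ, ℓ₀)`): every cluster through a point has total size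
`≥ 1`. [cite: FriedliVelenik2017, §7.4.2, Thm. 7.29, eq. (7.53)] -/
theorem abs_pressureOf_le (h : IsSmallTIActivity (S.rhoHat σ W) δ) : |S.pressureOf σ W| ≤ Real.exp (-δ) := by
  have h1 := h.norm_localPolymerPressure_sub_polymerPressureAt_le ∅ 0 (m := 1) fun C hxC _ _ => by
    obtain ⟨A, hA, h0A⟩ := mem_clusterSupp.1 hxC
    have : (1 : ℝ) ≤ (A.card : ℝ) := by exact_mod_cast card_pos.2 ⟨0, h0A⟩
    exact this.trans (single_le_sum (fun B _ => Nat.cast_nonneg _) hA)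
  rw [localPolymerPressure_empty, zero_sub, norm_neg, h.polymerPressureAt_eq_polymerPressure, mul_one] at h1
  exact (Complex.abs_re_le_norm _).trans h1

/-- **`g ≥ 0`**: the finite-volume logarithms are non-negative and `log Ξ(Λ_L)/|Λ_L| → g`.
[cite: FriedliVelenik2017, §7.4.2, Thm. 7.29 (with Ξ ≥ 1)] -/
theorem pressureOf_nonneg (h : IsSmallTIActivity (S.rhoHat σ W) δ) (hW0 : ∀ γ, 0 ≤ W γ) (hd : 1 ≤ d) :
    0 ≤ S.pressureOf σ W := by
  have ht := (Complex.continuous_re.tendsto _).comp (h.tendsto_polymerLogZ_box_div_card hd)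
  refine ge_of_tendsto' ht fun L => ?_
  simp only [Function.comp_apply]
  rw [Complex.div_natCast_re]
  exact div_nonneg (re_polymerLogZ_nonneg h hW0 _) (Nat.cast_nonneg _)

/-! ### Volume and boundary terms (FV eq. (7.54)) -/

/-- `‖y - x‖_∞ = d_∞(x, y)`. [folklore] -/
theorem supNorm_sub_eq_supDist (x y : Site d) : Site.supNorm (y - x) = supDist x y := by
  unfold Site.supNorm supDist
  congr 1
  funext i
  rw [Pi.sub_apply, ← Int.natAbs_neg, neg_sub]

/-- **Boundary term in the shrunk volume**: for `δ ≥ 2d+1`,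
`|log Ξ(V) - g |Vhat V|| ≤ 2 e^{-2δ} |∂^in (Vhat V)|`.
[cite: FriedliVelenik2017, §7.4.2, Thm. 7.29, eq. (7.54)] -/
theorem abs_log_compSum_sub_mul_card_Vhat_le (h : IsSmallTIActivity (S.rhoHat σ W) δ) (hW0 : ∀ γ, 0 ≤ W γ) (hd : 1 ≤ d)
    (hδ : 2 * d + 1 ≤ δ) (V : Finset (Site d)) :
    |Real.log (S.compSum σ W V) - S.pressureOf σ W * #(Vhat V)| ≤ 2 * Real.exp (-2 * δ) * #(inBoundary (Vhat V)) := by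
  set T := Vhat V with hT
  by_cases hTe : T = ∅
  · rw [compSum_eq_one_of_Vhat_eq_empty hTe, hTe, Real.log_one, card_empty, Nat.cast_zero, mul_zero, sub_zero, abs_zero]
    positivity
  have hTne : T.Nonempty := nonempty_iff_ne_empty.2 hTe
  have hBne : (inBoundary T).Nonempty := inBoundary_nonempty hd hTne
  -- the distance to the boundary
  set r : Site d → ℕ := fun x => ((inBoundary T).image fun b => supDist x b).min' (hBne.image _) with hr
  rw [log_compSum_eq h hW0, h.polymerLogZ_powerset_eq_sum_localPolymerPressure, pressureOf,
    show ((polymerPressure (S.rhoHat σ W)).re * #T : ℝ) = (∑ x ∈ T, polymerPressureAt (S.rhoHat σ W) x).re by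
      rw [sum_congr rfl fun x _ => h.polymerPressureAt_eq_polymerPressure x, sum_const, nsmul_eq_mul, Complex.mul_re]
      simp [mul_comm],
    ← Complex.sub_re, ← sum_sub_distrib]
  refine (Complex.abs_re_le_norm _).trans ((norm_sum_le _ _).trans ?_)
  calc ∑ x ∈ T, ‖localPolymerPressure (S.rhoHat σ W) T x - polymerPressureAt (S.rhoHat σ W) x‖
      ≤ ∑ x ∈ T, Real.exp (-δ * ((r x : ℕ) + 2)) := by
        refine sum_le_sum fun x hx => h.norm_localPolymerPressure_sub_polymerPressureAt_le T x fun C hxC hesc hC => ?_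
        -- escaping clusters are long
        obtain ⟨y, hyC, hyT⟩ := not_subset.1 hesc
        have hpath := reflTransGen_clusterSupp_of_isPolymerCluster (h.isPolymerCluster_of_ne_zero hC)
          (fun A hA => h.isRConnected_of_mem_of_ne_zero hC hA) hxC hyC
        have hcard := supNorm_sub_lt_card_of_reflTransGen hxC hpath
        rw [supNorm_sub_eq_supDist] at hcard
        obtain ⟨b, hb, hbxy⟩ := exists_inBoundary_near hx (supDist x y) y le_rfl hyT
        have hrb : r x ≤ supDist x b := min'_le _ _ (mem_image_of_mem (fun b => supDist x b) hb)
        have hsupp := card_clusterSupp_le_sum_card C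
        have : r x + 2 ≤ ∑ A ∈ C, A.card := by omega
        exact_mod_cast this
    _ ≤ 2 * Real.exp (-2 * δ) * #(inBoundary T) := sum_exp_boundaryDist_le hδ T hBne

/-- Numerical bound: for `δ ≥ 2d + 1`, `e^{-δ} + 2 e^{-2δ} 3^d ≤ 1`. [folklore] -/
theorem exp_neg_add_le_one (hδ : 2 * (d : ℝ) + 1 ≤ δ) : Real.exp (-δ) + 2 * Real.exp (-2 * δ) * 3 ^ d ≤ 1 := by
  have h3 : (3 : ℝ) ^ d ≤ Real.exp (2 * d) := by
    calc (3 : ℝ) ^ d ≤ Real.exp 2 ^ d := pow_le_pow_left₀ (by norm_num) (by have := Real.add_one_le_exp (2 : ℝ); linarith) d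
      _ = Real.exp (2 * d) := by rw [← Real.exp_nat_mul]; ring_nf
  have he1 : Real.exp (-δ) ≤ Real.exp (-1) := Real.exp_le_exp.2 (by have : (0 : ℝ) ≤ d := Nat.cast_nonneg d; linarith)
  have he : Real.exp (-1) ≤ 1 / 2 := by
    rw [Real.exp_neg, inv_le_comm₀ (Real.exp_pos 1) (by norm_num)]
    have := Real.add_one_le_exp (1 : ℝ); linarith
  have h2 : 2 * Real.exp (-2 * δ) * 3 ^ d ≤ Real.exp (-δ) := by
    calc 2 * Real.exp (-2 * δ) * 3 ^ d ≤ 2 * Real.exp (-2 * δ) * Real.exp (2 * d) := by gcongr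
      _ = 2 * Real.exp (-1 - (δ - 2 * d - 1)) * Real.exp (-δ) := by rw [mul_assoc, mul_assoc, ← Real.exp_add, ← Real.exp_add]; ring_nf
      _ ≤ 2 * Real.exp (-1) * Real.exp (-δ) := by gcongr; linarith
      _ ≤ 2 * (1 / 2) * Real.exp (-δ) := by gcongr
      _ = Real.exp (-δ) := by ring
  linarith

/-- **Volume and boundary terms for an arbitrary finite volume** (FV Thm. 7.29, eq. (7.54), with the
constant made explicit): for `δ ≥ 2d + 1`, `|log Ξ(V) - g |V|| ≤ |∂^in V|`, i.e.
`e^{g|V| - |∂^in V|} ≤ Ξ(V) ≤ e^{g|V| + |∂^in V|}`.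
[cite: FriedliVelenik2017, §7.4.2, Thm. 7.29, eq. (7.54) and eq. (7.71)] -/
theorem abs_log_compSum_sub_le (h : IsSmallTIActivity (S.rhoHat σ W) δ) (hW0 : ∀ γ, 0 ≤ W γ) (hd : 1 ≤ d)
    (hδ : 2 * d + 1 ≤ δ) (V : Finset (Site d)) :
    |Real.log (S.compSum σ W V) - S.pressureOf σ W * #V| ≤ #(inBoundary V) := by
  have h1 := abs_log_compSum_sub_mul_card_Vhat_le h hW0 hd hδ V
  have hp := abs_pressureOf_le h
  have hsd : (#(V \ Vhat V) : ℝ) = #V - #(Vhat V) := by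
    have := Finset.card_sdiff_add_card_eq_card (Vhat_subset V)
    have h' : (#(V \ Vhat V) : ℝ) + #(Vhat V) = #V := by exact_mod_cast this
    linarith
  have hb1 : (#(inBoundary (Vhat V)) : ℝ) ≤ 3 ^ d * #(inBoundary V) := by exact_mod_cast card_inBoundary_Vhat_le V
  have hb2 : (#(V \ Vhat V) : ℝ) ≤ #(inBoundary V) := by exact_mod_cast card_le_card (sdiff_Vhat_subset_inBoundary V)
  have hnum := exp_neg_add_le_one (d := d) (by exact_mod_cast hδ)
  have hkey : |S.pressureOf σ W * #(Vhat V) - S.pressureOf σ W * #V| ≤ Real.exp (-δ) * #(inBoundary V) := by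
    rw [← mul_sub, abs_mul, show |(#(Vhat V) : ℝ) - #V| = #(V \ Vhat V) by
      rw [hsd, abs_sub_comm, abs_of_nonneg (by rw [← hsd]; positivity)]]
    exact mul_le_mul hp hb2 (by positivity) (Real.exp_nonneg _)
  calc |Real.log (S.compSum σ W V) - S.pressureOf σ W * #V|
      = |(Real.log (S.compSum σ W V) - S.pressureOf σ W * #(Vhat V)) + (S.pressureOf σ W * #(Vhat V) - S.pressureOf σ W * #V)| := by
        ring_nf
    _ ≤ 2 * Real.exp (-2 * δ) * #(inBoundary (Vhat V)) + Real.exp (-δ) * #(inBoundary V) := (abs_add_le _ _).trans (add_le_add h1 hkey)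
    _ ≤ 2 * Real.exp (-2 * δ) * (3 ^ d * #(inBoundary V)) + Real.exp (-δ) * #(inBoundary V) := by gcongr
    _ = (Real.exp (-δ) + 2 * Real.exp (-2 * δ) * 3 ^ d) * #(inBoundary V) := by ring
    _ ≤ 1 * #(inBoundary V) := by gcongr
    _ = #(inBoundary V) := one_mul _

/-! ### Comparison of the pressures of two weight systems (FV Lemma 7.31) -/

/-- **Weights that agree on contours with small encoded support have close pressures**: if
`W(γ) ≠ W'(γ)` (type `σ`) forces `|cs γ̄| ≥ L₀`, then `|g_W - g_{W'}| ≤ 2 e^{-δ L₀}` (clusters through a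
point containing a contour with `|cs γ̄| ≥ L₀` have total size `≥ L₀`; Kotecký–Preiss tail bound, as
in FV Lemma 7.31). [cite: FriedliVelenik2017, §7.4.2, Lemma 7.31, eq. (7.60), and §7.4.3 (use of (7.73))] -/
theorem abs_pressureOf_sub_le {W' : S.Γ → ℝ} (h : IsSmallTIActivity (S.rhoHat σ W) δ)
    (h' : IsSmallTIActivity (S.rhoHat σ W') δ) {L₀ : ℕ}
    (hL : ∀ γ, S.type γ = σ → W γ ≠ W' γ → L₀ ≤ #(cs (S.supp γ))) :
    |S.pressureOf σ W - S.pressureOf σ W'| ≤ 2 * Real.exp (-δ * L₀) := by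
  -- notation: the two pressure series at `0`
  set ι := {C : Finset (Finset (Site d)) // (0 : Site d) ∈ clusterSupp C}
  set f : ι → ℂ := fun C => truncatedWeight polyInc (S.rhoHat σ W) C / ((clusterSupp (C : Finset (Finset (Site d)))).card : ℂ)
  set f' : ι → ℂ := fun C => truncatedWeight polyInc (S.rhoHat σ W') C / ((clusterSupp (C : Finset (Finset (Site d)))).card : ℂ)
  set F : ι → ℝ := fun C => ‖truncatedWeight polyInc (S.rhoHat σ W) C‖ *
    Real.exp (∑ A ∈ (C : Finset (Finset (Site d))), δ * A.card)
  set F' : ι → ℝ := fun C => ‖truncatedWeight polyInc (S.rhoHat σ W') C‖ *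
    Real.exp (∑ A ∈ (C : Finset (Finset (Site d))), δ * A.card)
  have hf : Summable f := h.summable_polymerPressureAt 0
  have hf' : Summable f' := h'.summable_polymerPressureAt 0
  obtain ⟨hF, hFle⟩ := h.summable_norm_mul_exp 0
  obtain ⟨hF', hF'le⟩ := h'.summable_norm_mul_exp 0
  have hδ0 : 0 ≤ δ := h.delta_pos.le
  -- pointwise bound on the difference of the terms
  have hpt : ∀ C : ι, ‖f C - f' C‖ ≤ Real.exp (-δ * L₀) * (F C + F' C) := by
    intro C
    by_cases hagree : ∀ B ∈ (C : Finset (Finset (Site d))), S.rhoHat σ W B = S.rhoHat σ W' B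
    · have : f C = f' C := by
        simp only [f, f', truncatedWeight_congr (inc := polyInc) hagree]
      rw [this, sub_self, norm_zero]
      positivity
    · -- a member with different merged weights is the encoding of a contour where `W ≠ W'`
      push Not at hagree
      obtain ⟨B, hB, hne⟩ := hagree
      have hL₀ : (L₀ : ℝ) ≤ ∑ A ∈ (C : Finset (Finset (Site d))), (A.card : ℝ) := by
        have hex : ∃ γ ∈ S.fibCs σ B, W γ ≠ W' γ := by
          by_contra hall
          push Not at hall
          exact hne (by rw [rhoHat_eq, rhoHat_eq, sum_congr rfl hall])
        obtain ⟨γ, hγ, hγne⟩ := hex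
        obtain ⟨ht, hcs⟩ := mem_fibCs.1 hγ
        have h1 : (L₀ : ℝ) ≤ (B.card : ℝ) := by exact_mod_cast hcs ▸ hL γ ht hγne
        exact h1.trans (single_le_sum (fun A _ => Nat.cast_nonneg _) hB)
      have hexp : (1 : ℝ) ≤ Real.exp (-δ * L₀) * Real.exp (∑ A ∈ (C : Finset (Finset (Site d))), δ * A.card) := by
        rw [← Real.exp_add, ← mul_sum]
        exact Real.one_le_exp (by nlinarith)
      have hn : ∀ (w : Finset (Site d) → ℂ), ‖truncatedWeight polyInc w C / ((clusterSupp (C : Finset (Finset (Site d)))).card : ℂ)‖ ≤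
          ‖truncatedWeight polyInc w C‖ := fun w => by
        rw [norm_div, Complex.norm_natCast]
        exact div_le_self (norm_nonneg _) (by exact_mod_cast card_pos.2 ⟨0, C.2⟩)
      calc ‖f C - f' C‖ ≤ ‖f C‖ + ‖f' C‖ := norm_sub_le _ _
        _ ≤ ‖truncatedWeight polyInc (S.rhoHat σ W) C‖ + ‖truncatedWeight polyInc (S.rhoHat σ W') C‖ := add_le_add (hn _) (hn _)
        _ ≤ (‖truncatedWeight polyInc (S.rhoHat σ W) C‖ + ‖truncatedWeight polyInc (S.rhoHat σ W') C‖) *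
              (Real.exp (-δ * L₀) * Real.exp (∑ A ∈ (C : Finset (Finset (Site d))), δ * A.card)) :=
            le_mul_of_one_le_right (by positivity) hexp
        _ = Real.exp (-δ * L₀) * (F C + F' C) := by simp only [F, F']; ring
  have hsum : Summable fun C => Real.exp (-δ * L₀) * (F C + F' C) := (hF.add hF').mul_left _
  calc |S.pressureOf σ W - S.pressureOf σ W'| = |(polymerPressure (S.rhoHat σ W) - polymerPressure (S.rhoHat σ W')).re| := by
        rw [pressureOf, pressureOf, Complex.sub_re]
    _ ≤ ‖polymerPressure (S.rhoHat σ W) - polymerPressure (S.rhoHat σ W')‖ := Complex.abs_re_le_norm _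
    _ = ‖∑' C, (f C - f' C)‖ := by rw [hf.tsum_sub hf']; rfl
    _ ≤ ∑' C, ‖f C - f' C‖ := norm_tsum_le_tsum_norm (hf.sub hf').norm
    _ ≤ ∑' C, Real.exp (-δ * L₀) * (F C + F' C) := (hf.sub hf').norm.tsum_le_tsum hpt hsum
    _ = Real.exp (-δ * L₀) * (∑' C, F C + ∑' C, F' C) := by rw [tsum_mul_left, hF.tsum_add hF']
    _ ≤ Real.exp (-δ * L₀) * (1 + 1) := by gcongr
    _ = 2 * Real.exp (-δ * L₀) := by ring

end ContourSetup

end Literature.Probability.LatticeModels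

end
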